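import Summits.BirchSwinnertonDyer.Rank1Residual.GaloisImage.FrobeniusOrderWitness
import Literature.NumberTheory.EllipticCurves.ModPImageTransvectionCriterionProofs
import Literature.NumberTheory.EllipticCurves.KatoKolyvaginPrimes
import Literature.NumberTheory.EllipticCurves.HidaFamilyMembersProofs
import Literature.NumberTheory.EllipticCurves.Rank1Residual.Predicates
import HarnessLib

/-!
# At a prime of IRREDUCIBLE but NON-SURJECTIVE mod-`p` image every Kolyvagin prime `ℓ` has
# `Frob_ℓ = 1` on `E[p]`, hence `p² ∣ #Ẽ(𝔽_ℓ)` — the Kolyvagin / Kurihara-number routes have NO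
# admissible level there (cell `b2b-bsdres`, unit `b2b-bsdres-additive-p3`, gen 5; a class-agnostic no-go)

HONEST FRAMING (run/shared/lean/b2b/bsd-rank1-residual/, verbatim in every file): the goal of the
cell is to DELETE the COMBINATION-SHAPED residual classes of the Birch–Swinnerton-Dyer formula for
ALL analytic-rank `≤ 1` elliptic curves over `ℚ` — "full BSD formula for every rank `≤ 1` curve in
class `C`" assembled STRICTLY from published theorems — so that the rank-`≤ 1` remainder becomes
exactly the CONSTRUCTION-SHAPED classes, which are TYPED (missing-input `Prop`s), NOT attempted.
This is not "finishing BSD". THEOREMS ONLY (no definition, no named fact; nothing booked; labels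
unchanged). A NO-GO, not a class theorem.

## What this file proves, and why

The per-pair Kolyvagin-system / Kurihara-number routes of the cell (Kim, Amer. J. Math. 2026,
Thm. 1.8/1.10; Kim–Kim–Sun 2020 Thm. 1.1; Kurihara's `δ̃_n`; the tree's typed input
`X4.KuriharaUnitAt`, Mazur–Rubin's hypothesis (im) `BigIm`) work at square-free products of
KOLYVAGIN PRIMES `ℓ ∈ 𝒫₁(E, p)`: `ℓ ∤ Np`, `ℓ ≡ 1 (mod p)`, `a_ℓ ≡ ℓ + 1 (mod p)`
(`Kato.IsKolyvaginPrime W p 1 ℓ`), and need `Ẽ(𝔽_ℓ)[p] ≅ ℤ/p` CYCLIC (Kurihara's `𝒫_{1,0}`), i.e. a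
Frobenius at `ℓ` acting on `E[p]` as a TRANSVECTION (`det = 1`, `tr = 2`, `≠ 1`). The census found
(X8-ROUTE-B §6(i): `6241a1`, `10816u1` at `p = 3`, image `3Nn`; X7 `6372a1`, `18324a1` at `5`;
X10b; all of X9) that at the non-surjective irreducible pairs EVERY Kolyvagin prime had
`p² ∣ #Ẽ(𝔽_ℓ)`. This is a theorem:

* `galoisRepTorsion_frobenius_eq_one_of_irr_of_not_surj` — **`E[p]` irreducible, `ρ̄_{E,p}` not
  onto, `ℓ ≠ p` good with `ℓ ≡ 1`, `a_ℓ ≡ 2 (mod p)` ⟹ every arithmetic Frobenius at a prime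
  above `ℓ` acts TRIVIALLY on `E[p]`** (`ℓ` splits completely in `ℚ(E[p])`). Proof: in a frame
  `E[p] ≅ 𝔽_p²` the Frobenius `g` has `det g = χ̄_p = ℓ = 1`, `tr g = a_ℓ = 2`, so
  `det(g − 1) = 0`; the image `G` is proper with `det G = 𝔽_pˣ` and no common eigenvector, and the
  x9 seat's reading of Serre's Prop. 15 (`Serre1972.eq_one_of_det_eq_one_of_det_sub_one_eq_zero`:
  such a `G` contains no transvection) forces `g = 1`.
* `sq_dvd_reductionPointCount_of_irr_of_not_surj` — **hence `p² ∣ #Ẽ(𝔽_ℓ)`** (x11c's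
  `sq_dvd_reductionPointCount_of_forall_smul_eq`: the reduction map embeds `E[p]`, `p²` points, into
  `Ẽ(𝔽_ℓ)` when Frobenius fixes it — so in fact `E[p] ⊂ Ẽ(𝔽_ℓ)` and `Ẽ(𝔽_ℓ)[p]` is NOT cyclic; the
  kernel statement records the point-count shadow `p² ∣ #Ẽ(𝔽_ℓ)`, the group embedding living inside
  that proof).
* `sq_dvd_reductionPointCount_of_isKolyvaginPrime` — the same in Kim's vocabulary: `Irr W p`,
  `¬ Surj W p`, `Kato.IsKolyvaginPrime W p 1 ℓ` ⟹ `p² ∣ W.reductionPointCount ℓ`; readings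
  `ClassX9.sq_dvd_reductionPointCount_of_isKolyvaginPrime` (all of X9) and
  `ClassX10.sq_dvd_reductionPointCount_of_isKolyvaginPrime_of_not_surj` (X10b).

So on `Irr ∧ ¬Surj` pairs Kurihara's set `𝒫_{1,0}` is EMPTY and `𝒩_{1,0} = {1}`: the only
Kurihara number is `δ̃_1 = [0]⁺ = L(E,1)/Ω⁺` (no information beyond `L(E,1)`), and Mazur–Rubin's
useful Galois element does not exist (x9: `not_bigIm_of_irr_of_not_surj`) — the structural reason
the lane found "no cyclic level" at `6241a1/10816u1 @ 3` and why no Kurihara certificate can ever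
be issued for X9, X10b or the `3Nn`/`5Nn` supersingular pairs. (Reducible `E[p]` — X1/X2/X3 — is
the opposite regime: transvections abound.) Nothing booked; labels unchanged.

References: J.-P. Serre, Invent. Math. 15 (1972) §2.4 Prop. 15 [Serre1972]; C.-H. Kim, Amer. J.
Math. (2026) = arXiv:2203.12159 §1.2.2 (`𝒫_k`) [Kim2022StructureSelmer]; R. Sakamoto, Doc. Math. 27
(2022) Conj. 1.1 (`𝒫_{1,0}`, `𝒩_{1,0}`) [Sakamoto2022pSelmer]; B. Mazur, K. Rubin, Mem. AMS 799
(2004) §3.5 (H.4)/(useful primes); J. H. Silverman, AEC VII.3.1(b) [SilvermanAEC2009].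
-/

noncomputable section

open scoped Classical MatrixGroups
open NumberField IsDedekindDomain IsDedekindDomain.HeightOneSpectrum Field WeierstrassCurve
  Literature.NumberTheory.EllipticCurves Literature.NumberTheory.GaloisRepresentations
  Literature.NumberTheory.GaloisRepresentations.Serre1972
  Literature.NumberTheory.EllipticCurves.Rank1Residual

namespace Summit.BirchSwinnertonDyer.Rank1Residual.GaloisImage

/-- **Irreducible, non-surjective image ⟹ Frobenius at a Kolyvagin prime is TRIVIAL on `E[p]`.**
Let `W/ℚ` be a globally minimal elliptic curve, `p` a prime with `E[p]` irreducible and `ρ̄_{E,p}`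
not surjective, `ℓ ≠ p` a prime of good reduction with `ℓ ≡ 1 (mod p)` and `a_ℓ ≡ 2 (mod p)`, `v`
the place above `ℓ`, `𝔓 ∣ v`, `φ` an arithmetic Frobenius at `𝔓`. Then `ρ̄_{E,p}(φ) = 1`. (In a
frame, `g = Φ(ρ̄(φ))` has `det g = χ̄_p(φ) = ℓ = 1`, `tr g = a_ℓ = 2`, `det(g−1) = 0`; the image is
proper, with full determinant and no common eigenvector, so by Serre's Prop. 15 read backwards
(`eq_one_of_det_eq_one_of_det_sub_one_eq_zero`) it contains no transvection: `g = 1`.)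
[cite: Serre1972, §2.4 Prop. 15 and §5.2 (iii)] -/
theorem galoisRepTorsion_frobenius_eq_one_of_irr_of_not_surj (W : WeierstrassCurve ℚ)
    [W.IsElliptic] [W.IsGloballyMinimal] (p ℓ : ℕ) [Fact p.Prime] [Fact ℓ.Prime] (hℓp : ℓ ≠ p)
    (hgood : W.HasGoodReductionAtPrime ℓ) (hirr : W.HasIrreducibleModPGaloisRep p)
    (hns : ¬ W.HasSurjectiveModNGaloisRep p) (hℓ1 : (ℓ : ZMod p) = 1)
    (htr : (W.frobeniusTrace ℓ : ZMod p) = 2) {v : HeightOneSpectrum (𝓞 ℚ)}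
    (hvℓ : (Rat.HeightOneSpectrum.primesEquiv v : ℕ) = ℓ) {𝔓 : Ideal (absIntegers (𝓞 ℚ) ℚ)}
    (h𝔓 : 𝔓 ∈ v.primesAbove) {φ : absoluteGaloisGroup ℚ} (hφ : IsArithFrobAt (𝓞 ℚ) φ 𝔓) :
    galoisRepTorsion W p φ = 1 := by
  letI : Module (ZMod p) (geomTorsion W p) := AddSubgroup.torsionBy.zmodModule
  have hv : (ℓ : 𝓞 ℚ) ∈ v.asIdeal := by
    rw [DeuringLadic.natCast_mem_asIdeal_iff v ℓ, hvℓ]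
  obtain ⟨e, Φ, he, hΦ, hdet, -, -⟩ := W.exists_frame_galoisRepTorsion_rat p
  set G := (galoisRepTorsion W p).range.map Φ.toMonoidHom with hG
  set g : GL (Fin 2) (ZMod p) := Φ (galoisRepTorsion W p φ) with hgdef
  have hgG : g ∈ G := apply_galoisRepTorsion_mem_map_range W p Φ φ
  have htrg : (g : Matrix (Fin 2) (Fin 2) (ZMod p)).trace = 2 := by
    rw [hgdef, hΦ, W.trace_galoisRepTorsion_frobenius_eq p hℓp hgood hvℓ h𝔓 hφ, htr]
  have hdetg : Matrix.GeneralLinearGroup.det g = 1 := by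
    apply Units.ext
    rw [hgdef, hdet, Mazur1978.modPCyclotomicCharacterZMod_of_isArithFrobAt p ℓ hℓp hv h𝔓 hφ,
      Units.val_one, hℓ1]
  have hsing : ((g : Matrix (Fin 2) (Fin 2) (ZMod p)) - 1).det = 0 := by
    rw [det_sub_one_fin_two, ← Matrix.GeneralLinearGroup.val_det_apply, hdetg, Units.val_one, htrg]
    ring
  -- the image is proper, has full determinant and no common eigenvector
  have hGtop : G ≠ ⊤ := fun h ↦ hns ((map_range_galoisRepTorsion_eq_top_iff W p Φ).mp h)
  have hdetG : ∀ u : (ZMod p)ˣ, ∃ g ∈ G, Matrix.GeneralLinearGroup.det g = u :=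
    exists_mem_map_range_det_eq W p Φ e he
  have hirrG : ∀ (w : Fin 2 → ZMod p) (hw : w ≠ 0), ¬ G ≤ eigenvectorStabilizer w hw :=
    fun w hw ↦ not_le_eigenvectorStabilizer_of_hasIrreducibleModPGaloisRep W p Φ e he hirr hw
  have hg1 : g = 1 := eq_one_of_det_eq_one_of_det_sub_one_eq_zero G hdetG hGtop hirrG hgG hdetg hsing
  apply Φ.injective
  rw [map_one]
  exact hg1

/-- **Irreducible, non-surjective image ⟹ `p² ∣ #Ẽ(𝔽_ℓ)` at every prime `ℓ ≠ p` of good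
reduction with `ℓ ≡ 1`, `a_ℓ ≡ 2 (mod p)`** (the Kolyvagin primes of `(E, p)`): the Frobenius at `ℓ`
fixes `E[p]` (`galoisRepTorsion_frobenius_eq_one_of_irr_of_not_surj`), so the reduction map embeds
the `p²` points of `E[p]` into `Ẽ(𝔽_ℓ)` (x11c, `sq_dvd_reductionPointCount_of_forall_smul_eq`;
Silverman AEC VII.3.1(b)). In particular `Ẽ(𝔽_ℓ)[p]` is not cyclic of order `p`: no such `ℓ` is a
Kurihara level. [cite: Serre1972, §2.4 Prop. 15] [cite: SilvermanAEC2009, Prop. VII.3.1(b)] -/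
theorem sq_dvd_reductionPointCount_of_irr_of_not_surj (W : WeierstrassCurve ℚ) [W.IsElliptic]
    [W.IsGloballyMinimal] (p ℓ : ℕ) [Fact p.Prime] [hℓF : Fact ℓ.Prime] (hℓp : ℓ ≠ p)
    (hgood : W.HasGoodReductionAtPrime ℓ) (hirr : W.HasIrreducibleModPGaloisRep p)
    (hns : ¬ W.HasSurjectiveModNGaloisRep p) (hℓ1 : (ℓ : ZMod p) = 1)
    (htr : (W.frobeniusTrace ℓ : ZMod p) = 2) : p ^ 2 ∣ W.reductionPointCount ℓ := by
  set v : HeightOneSpectrum (𝓞 ℚ) := (Rat.HeightOneSpectrum.primesEquiv (R := 𝓞 ℚ)).symm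
    ⟨ℓ, hℓF.out⟩ with hvdef
  have hvℓ : (Rat.HeightOneSpectrum.primesEquiv v : ℕ) = ℓ := by
    rw [hvdef, Equiv.apply_symm_apply]
  have hv : (ℓ : 𝓞 ℚ) ∈ v.asIdeal := by
    rw [DeuringLadic.natCast_mem_asIdeal_iff v ℓ, hvℓ]
  obtain ⟨𝔓, h𝔓⟩ := v.primesAbove_nonempty
  obtain ⟨φ, hφ⟩ := HeightOneSpectrum.exists_isArithFrobAt_of_mem_primesAbove_holds (v := v) h𝔓
  have hρ := galoisRepTorsion_frobenius_eq_one_of_irr_of_not_surj W p ℓ hℓp hgood hirr hns hℓ1 htr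
    hvℓ h𝔓 hφ
  refine sq_dvd_reductionPointCount_of_forall_smul_eq W p ℓ hℓp hgood hv h𝔓 hφ fun P ↦ ?_
  have h1 : (galoisRepTorsion W p φ).toAdd P = P := by rw [hρ]; rfl
  exact h1

/-- **The no-go in Kim's vocabulary.** For a globally minimal `E = W/ℚ` and a prime `p` with
`irr(p) ∧ ¬surj(p)` (cell predicates `Irr`, `Surj`), EVERY Kolyvagin prime `ℓ ∈ 𝒫₁(E,p)`
(`Kato.IsKolyvaginPrime W p 1 ℓ`: `ℓ ∤ N_E p`, `ℓ ≡ 1`, `a_ℓ ≡ ℓ + 1 (mod p)`; Kim §1.2.2) has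
`p² ∣ #Ẽ(𝔽_ℓ)`. So Kurihara's cyclic levels `𝒫_{1,0}` (Sakamoto 2022, Conj. 1.1: `E(𝔽_ℓ)[p] ≅ 𝔽_p`)
do not exist there and the typed input `X4.KuriharaUnitAt` can only be witnessed at `n = 1`.
[cite: Kim2022StructureSelmer, §1.2.2] [cite: Sakamoto2022pSelmer, Conj. 1.1]
[cite: Serre1972, §2.4 Prop. 15] -/
theorem sq_dvd_reductionPointCount_of_isKolyvaginPrime (W : WeierstrassCurve ℚ) [W.IsElliptic]
    [W.IsGloballyMinimal] (p : ℕ) [hp : Fact p.Prime] (hirr : Irr W p) (hns : ¬ Surj W p) {ℓ : ℕ}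
    (hK : Kato.IsKolyvaginPrime W p 1 ℓ) : p ^ 2 ∣ W.reductionPointCount ℓ := by
  haveI : Fact ℓ.Prime := ⟨hK.prime⟩
  have hgood : W.HasGoodReductionAtPrime ℓ :=
    hasGoodReductionAtPrime_of_not_dvd_conductorNorm W hK.not_dvd_conductorNorm
  have hℓ1 : (ℓ : ZMod p) = 1 := by
    have h := hK.modEq_one
    rw [pow_one] at h
    have h' := (ZMod.natCast_eq_natCast_iff ℓ 1 p).mpr h
    rwa [Nat.cast_one] at h'
  have htr : (W.frobeniusTrace ℓ : ZMod p) = 2 := by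
    have h := hK.frobeniusTrace_modEq
    rw [pow_one] at h
    have h' := (ZMod.intCast_eq_intCast_iff _ _ _).mpr h
    rw [Int.cast_add, Int.cast_natCast, Int.cast_one, hℓ1] at h'
    rw [h']
    norm_num
  exact sq_dvd_reductionPointCount_of_irr_of_not_surj W p ℓ hK.ne hgood hirr hns hℓ1 htr

/-- **X9 (residually small, irreducible image at good ordinary `p ≥ 5`): every Kolyvagin prime has
`p² ∣ #Ẽ(𝔽_ℓ)`** — no Kurihara / Kolyvagin level exists on the whole class (companion of the x9
seat's `ClassX9.not_bigIm`). [cite: Serre1972, §2.4 Prop. 15] -/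
theorem ClassX9.sq_dvd_reductionPointCount_of_isKolyvaginPrime (W : WeierstrassCurve ℚ)
    [W.IsElliptic] [W.IsGloballyMinimal] (p : ℕ) [Fact p.Prime] (hX : ClassX9 W p) {ℓ : ℕ}
    (hK : Kato.IsKolyvaginPrime W p 1 ℓ) : p ^ 2 ∣ W.reductionPointCount ℓ :=
  Summit.BirchSwinnertonDyer.Rank1Residual.GaloisImage.sq_dvd_reductionPointCount_of_isKolyvaginPrime
    W p hX.2.2.2.1 hX.2.2.2.2.1 hK

/-- **X10 ∧ ¬surj(3) (= X10b): every Kolyvagin prime at `p = 3` has `9 ∣ #Ẽ(𝔽_ℓ)`.**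
[cite: Serre1972, §2.4 Prop. 15] -/
theorem ClassX10.sq_dvd_reductionPointCount_of_isKolyvaginPrime_of_not_surj (W : WeierstrassCurve ℚ)
    [W.IsElliptic] [W.IsGloballyMinimal] (p : ℕ) [Fact p.Prime] (hX : ClassX10 W p)
    (hns : ¬ Surj W 3) {ℓ : ℕ} (hK : Kato.IsKolyvaginPrime W 3 1 ℓ) :
    3 ^ 2 ∣ W.reductionPointCount ℓ :=
  haveI : Fact (Nat.Prime 3) := ⟨Nat.prime_three⟩
  Summit.BirchSwinnertonDyer.Rank1Residual.GaloisImage.sq_dvd_reductionPointCount_of_isKolyvaginPrime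
    W 3 hX.2.2.1 hns hK

end Summit.BirchSwinnertonDyer.Rank1Residual.GaloisImage

end
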